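import Summits.QuantumFields.YangMills.Theorems.LuscherReductionDressedRitzPolyakovLiftPScalingVectors
import Summits.QuantumFields.YangMills.Theorems.LuscherReductionDressedRitzPolyakovLiftPScalingCoreGap
import Summits.QuantumFields.YangMills.Theorems.LuscherReductionDressedRitzPolyakovLiftTransplantRootR
import Summits.QuantumFields.YangMills.Theorems.LuscherReductionDressedRitzPolyakovLiftPScalingPrep
import HarnessLib

/-!
# Route `LuscherReduction`, item `DressedRitz` (stmt-QuantumFields-20205), line «polyakovlift» r7, stub S-PSCAL″ — THE ASSEMBLY CORE AT ONE COUPLING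
# (F9 layer D5a: everything but the choice of constants; LEAD prover ym-lead-20205-polyakovlift g2)

Fix the level `k`, a cluster end `K ≥ k` of the invariant spectrum of `𝔥` (`PScal.exists_clusterEnd`), an AL1 family `F_0,…,F_K` with `F_0 > 0`, the fine size `L`, the
scale `Λ`, radii `R` (observable, `1 ≤ R`, `1 ≤ R⁴Λ`, `RΛ ≤ 1/4`) and `R_v ≥ √2R` (vacuum quasimode, `√2R_vΛ < π`), the coupling `B = 2L³/Λ³` and a raw one-site vacuum
`e₀` at `B`.  GIVEN (as hypotheses, produced elsewhere from F6 `TransplantForms.oneSite_package`, `PScal.levels_window`, the ground-state lower bound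
`YMMatrixModel.luscherGroundStateLowerBound` and `PolyakovLift.abs_transplantFn_le_of_quarticFloor`):
(Q) the quasimode package of the explicit family `Ψ_j = (χ_{ρ_j}F_j)∘gnCoord (Λ/(2L))` in the currency of `PScal.shadowVectors_concentrated`
    (first moments, near-orthogonality, window/gap data, cluster smallness, contamination smallness with `ϑ = Λ²`);
(D) the dressed level data in the currency of `PScal.dressed_clauses_of_concentration'` (spread `σ`, floor `λ_low`, power ratio `Γ` at `n = L`, tolerance `τ`,
    the two scalar smallness conditions and the per-window gap condition);
(C) one constant `C` with `τ ≤ CΛ²/L` and `Ω ≤ C(Λ²/L)λ_0` (`Ω` the explicit cross constant of the dressed clauses), and antitone levels (tree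
    `KTRCalibration.levelValue_antitone`, supplied by the caller to keep this file out of the route cone),
THEN (★★★ `pscaling_core`) the transplanted observables `g_i = transplantObsL L Λ R f i` (`f` = first `k+1` members of `F`) form an r7 basis
(`TransplantBasisLR k L Λ g`) whose shadow family `w_i = K^[L] ins_{e₀}(g_i ∘ powLink L)` satisfies (o0′)(o5′)(o6′) with this `C` — i.e. LITERALLY the body of
`PScalingExistsForL (TransplantBasisLR k)` at `(L, Λ, e₀)`.  Chain: `SpecSum.exists_spectral_eigenseq` (frame), `PScal.rawVacuum_eq_smul` (`e₀ = ±e_0`),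
`PScal.shadowVectors_concentrated` (window concentration of the `v_i`), `PScal.dressed_clauses_of_concentration'`.

HONEST FRAMING: fixed-lattice one-site bookkeeping (conditional femto rung R2b1); nothing here bears on infinite volume, the continuum limit or the Clay gap.
References: Reed–Simon IV, Thm. XIII.1 [cite: ReedSimonIV1978, Thm. XIII.1]; M. Lüscher, NPB 219 (1983) 233 [cite: Luscher1983, §2–§3].
-/

set_option autoImplicit false

noncomputable section

open MeasureTheory Filter Topology Real Finset
open Literature.MathematicalPhysics.QuantumFieldTheory (GaugeConfig Site gaugeTransform)
open Literature.Analysis.OperatorTheory.YMMatrixModel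
open scoped BigOperators

namespace Summit.QuantumFields.YangMills.Theorems.FemtoTransferGap.PScal

open Summit.QuantumFields.YangMills.Theorems.FemtoTransferGap
open Summit.QuantumFields.YangMills.Theorems.FemtoTransferGap.PolyakovLift
open Summit.QuantumFields.YangMills.Theorems.FemtoTransferGap.ClusterInd (clusterDelta)

variable {K k : ℕ}

/-- ★★★ **The assembly core at one coupling** (dictionary in the module docstring). [cite: ReedSimonIV1978, Thm. XIII.1] [cite: Luscher1983, §2–§3] -/
theorem pscaling_core (hkK : k ≤ K) (hK : idxLevel K < idxLevel (K + 1)) {F : Fin (K + 1) → ZM → ℝ} (hF : IsEigenFamily K F) (hFpos : ∀ x, 0 < F 0 x)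
    {L : ℕ} (hL : 1 ≤ L) {Λ : ℝ} (hΛ : 0 < Λ) (hΛ2 : Λ ^ 2 ≤ 1 / 4)
    {R Rv : ℝ} (hR1 : 1 ≤ R) (hR4 : 1 ≤ R ^ 4 * Λ) (hRΛ : R * Λ ≤ 1 / 4) (hRRv : Real.sqrt 2 * R ≤ Rv) (hRvΛ : Real.sqrt 2 * Rv * Λ < π)
    {B : ℝ} (hBdef : B = 2 * (L : ℝ) ^ 3 / Λ ^ 3) (hanti : Antitone fun j => levelValue su2Rep 1 B j)
    -- (Q) quasimode package
    (Ψ : Fin (K + 1) → Cfg → ℝ)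
    (hΨ0 : Ψ 0 = fun U => radialCutoff Rv (gnCoord (Λ / (2 * L)) U) * F 0 (gnCoord (Λ / (2 * L)) U))
    (hΨsucc : ∀ j : Fin (K + 1), 1 ≤ (j : ℕ) → Ψ j = fun U => radialCutoff R (gnCoord (Λ / (2 * L)) U) * F j (gnCoord (Λ / (2 * L)) U))
    (hΨphys : ∀ j, IsPhys (Ψ j)) (hΨpos : ∀ j, 0 < l2 (Ψ j) (Ψ j))
    {θ : Fin (K + 1) → ℝ} (hθ : ∀ j, θ j * l2 (Ψ j) (Ψ j) ≤ qform su2Rep B (Ψ j) (Ψ j))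
    {ε s κ : ℝ} (hε : 0 ≤ ε) (hs : 0 ≤ s) (hκ : 0 ≤ κ)
    (hgram : ∀ j j' : Fin (K + 1), j ≠ j' → |l2 (Ψ j) (Ψ j')| ≤ ε * Real.sqrt (l2 (Ψ j) (Ψ j)) * Real.sqrt (l2 (Ψ j') (Ψ j')))
    (hgap : ∀ j : Fin (K + 1), 0 < levelValue su2Rep 1 B (winLo j) - levelValue su2Rep 1 B (winHi j))
    (hsj : ∀ j : Fin (K + 1), levelValue su2Rep 1 B (winLo j) - θ j ≤ s * (levelValue su2Rep 1 B (winLo j) - levelValue su2Rep 1 B (winHi j)))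
    (hκj : ∀ j : Fin (K + 1), levelValue su2Rep 1 B 0 - levelValue su2Rep 1 B (winLo j) ≤
      κ * (levelValue su2Rep 1 B (winLo j) - levelValue su2Rep 1 B (winHi j)))
    (hsmall : ((K + 1 : ℕ) : ℝ) * (ε + clusterDelta (K + 1) κ ε s (K + 1)) ≤ 1 / 2)
    (hθ0 : levelValue su2Rep 1 B 1 < θ 0)
    {Cf : ℝ} (hCf0 : 0 ≤ Cf) (hCf : ∀ (i : Fin k) (y : ZM), |transplantFn R (fun j => F (Fin.castLE (Nat.succ_le_succ hkK) j)) i y| ≤ Cf)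
    (hδ : clusterDelta (K + 1) κ ε s (K + 1) ≤ Λ ^ 2 / 4)
    (hηsmall : ∀ i : Fin k, Cf ^ 2 * ((levelValue su2Rep 1 B 0 - θ 0) / (θ 0 - levelValue su2Rep 1 B 1) * l2 (Ψ 0) (Ψ 0)) ≤
      (Λ ^ 2 / 8) ^ 2 * l2 (Ψ ⟨(i : ℕ) + 1, by omega⟩) (Ψ ⟨(i : ℕ) + 1, by omega⟩))
    -- (D) dressed level data at `n = L`
    {σ lamlow Γ τ : ℝ}
    (hσ : ∀ (i : Fin k) (m : ℕ), winLo ((i : ℕ) + 1) ≤ m → m < winHi ((i : ℕ) + 1) →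
      |levelValue su2Rep 1 B m - levelValue su2Rep 1 B ((i : ℕ) + 1)| ≤ σ)
    (hlow0 : 0 < lamlow) (hlow : ∀ (i : Fin k) (m : ℕ), winLo ((i : ℕ) + 1) ≤ m → m < winHi ((i : ℕ) + 1) → lamlow ≤ levelValue su2Rep 1 B m)
    (hΓ : levelValue su2Rep 1 B 0 ^ (2 * L) ≤ Γ * lamlow ^ (2 * L))
    (hτ0 : 0 ≤ τ) (hτ1 : τ ≤ 1)
    (hup : ∀ i : Fin k, Γ * ((levelValue su2Rep 1 B 0 - levelValue su2Rep 1 B ((i : ℕ) + 1)) * Λ ^ 2 + σ) ≤ τ * levelValue su2Rep 1 B ((i : ℕ) + 1))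
    (hlo' : ∀ i : Fin k, Γ * (σ + levelValue su2Rep 1 B ((i : ℕ) + 1) * Λ ^ 2 / (2 * (L : ℝ) + 1)) ≤ τ / 2 * levelValue su2Rep 1 B ((i : ℕ) + 1))
    (hgapτ : ∀ i : Fin k, levelValue su2Rep 1 B (winHi ((i : ℕ) + 1)) ≤ Real.exp (-τ) * levelValue su2Rep 1 B ((i : ℕ) + 1))
    -- (C) the final currency
    {C : ℝ} (hτC : τ ≤ C * Λ ^ 2 / L)
    (hΩC : (1 + Λ ^ 2) * Γ * (σ + (Real.exp τ - 1) * levelValue su2Rep 1 B 0 +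
        2 * Real.sqrt (Λ ^ 2) * (Real.exp τ * levelValue su2Rep 1 B 0 - Real.exp (-τ) * lamlow) +
        Real.exp ((2 * (L : ℝ) + 1) * τ) * levelValue su2Rep 1 B 0 * Λ ^ 2 / (2 * (L : ℝ) + 1)) ≤ C * (Λ ^ 2 / L) * levelValue su2Rep 1 B 0)
    -- the raw vacuum
    (e₀ : Cfg → ℝ) (he₀ : IsRawVacuum (L := 1) B e₀) :
    ∃ g : Fin k → (Cfg → ℝ), TransplantBasisLR k L Λ g ∧
      (∀ i : Fin k, 0 < l2 (shadowFamily B L e₀ g i) (shadowFamily B L e₀ g i)) ∧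
      (∀ i : Fin k,
        l2 (shadowFamily B L e₀ g i) (transferApply B (shadowFamily B L e₀ g i)) * levelValue su2Rep 1 B 0 ≤
            Real.exp (C * Λ ^ 2 / L) * (levelValue su2Rep 1 B ((i : ℕ) + 1) * levelValue su2Rep 1 B 0) *
              l2 (shadowFamily B L e₀ g i) (shadowFamily B L e₀ g i) ∧
          levelValue su2Rep 1 B ((i : ℕ) + 1) * levelValue su2Rep 1 B 0 * l2 (shadowFamily B L e₀ g i) (shadowFamily B L e₀ g i) ≤
            Real.exp (C * Λ ^ 2 / L) * (l2 (shadowFamily B L e₀ g i) (transferApply B (shadowFamily B L e₀ g i)) * levelValue su2Rep 1 B 0)) ∧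
      (∀ i l : Fin k, i ≠ l →
        |l2 (shadowFamily B L e₀ g i) (transferApply B (shadowFamily B L e₀ g l)) -
            (l2 (shadowFamily B L e₀ g i) (transferApply B (shadowFamily B L e₀ g i)) /
                  l2 (shadowFamily B L e₀ g i) (shadowFamily B L e₀ g i) +
                l2 (shadowFamily B L e₀ g l) (transferApply B (shadowFamily B L e₀ g l)) /
                  l2 (shadowFamily B L e₀ g l) (shadowFamily B L e₀ g l)) / 2 *
              l2 (shadowFamily B L e₀ g i) (shadowFamily B L e₀ g l)|
          ≤ C * (Λ ^ 2 / L) * levelValue su2Rep 1 B 0 *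
            (Real.sqrt (l2 (shadowFamily B L e₀ g i) (shadowFamily B L e₀ g i)) *
              Real.sqrt (l2 (shadowFamily B L e₀ g l) (shadowFamily B L e₀ g l)))) := by
  -- positivity of the coupling, antitone and non-negative levels
  have hLpos : (0 : ℝ) < L := by exact_mod_cast hL
  have hB : 0 < B := by rw [hBdef]; positivity
  set lam : ℕ → ℝ := fun j => levelValue su2Rep 1 B j with hlam
  have hnn : ∀ j, 0 ≤ lam j := fun j => levelValue_nonneg_of_qform_nonneg su2Rep B (fun ψ hψ => qform_su2Rep_self_nonneg hB.le hψ) j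
  -- the adapted frame
  obtain ⟨e, hon, heig, hdom, hsum, hbes⟩ := SpecSum.exists_spectral_eigenseq (L := 1) hB
  -- the raw vacuum is `± e 0`
  obtain ⟨he₀P, he₀n, he₀eig⟩ := he₀
  have hw0 : winLo 0 = 0 := Nat.le_zero.1 (winLo_le 0)
  have hgap01 : lam 1 < lam 0 := by
    have h := hgap 0
    simp only [Fin.val_zero, hw0, winHi_zero] at h
    exact sub_pos.1 h
  have hdomE : ∀ ψ : Cfg → ℝ, IsPhys ψ → l2 ψ ((e 0 : physSubmodule 1) : Cfg → ℝ) = 0 → qform su2Rep B ψ ψ ≤ lam 1 * l2 ψ ψ :=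
    fun ψ hψ h0 => hdom 1 ψ hψ (fun i hi => by
      have hi0 : i = 0 := by omega
      rw [hi0]; exact h0)
  obtain ⟨hσe, hσ2⟩ := rawVacuum_eq_smul (L := 1) hB ⟨he₀P, he₀n, he₀eig⟩ (e 0).2 (hon 0 0 |>.trans (if_pos rfl)) (heig 0) hgap01 hdomE
  set c₀ := l2 e₀ ((e 0 : physSubmodule 1) : Cfg → ℝ) with hc₀
  have hc₀ne : c₀ ≠ 0 := by intro h; rw [h] at hσ2; norm_num at hσ2
  have horth0 : ∀ m, 1 ≤ m → l2 e₀ ((e m : physSubmodule 1) : Cfg → ℝ) = 0 := by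
    intro m hm
    rw [hσe, l2_smul_left, hon 0 m, if_neg (by omega), mul_zero]
  have hdom1 : ∀ ψ : Cfg → ℝ, IsPhys ψ → l2 ψ e₀ = 0 → qform su2Rep B ψ ψ ≤ lam 1 * l2 ψ ψ := by
    intro ψ hψ h0
    refine hdomE ψ hψ ?_
    rw [hσe, l2_smul_right] at h0
    rcases mul_eq_zero.1 h0 with h | h
    · exact absurd h hc₀ne
    · exact h
  -- the basis
  set f : Fin (k + 1) → ZM → ℝ := fun j => F (Fin.castLE (Nat.succ_le_succ hkK) j) with hfdef
  have hf : IsEigenFamily k f := isEigenFamily_castLE hkK hF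
  set g : Fin k → Cfg → ℝ := fun i => transplantObsL L Λ R f i with hgdef
  have hbasis : TransplantBasisLR k L Λ g := ⟨f, R, hf, hFpos, hR1, hR4, hRΛ, fun _ => rfl⟩
  refine ⟨g, hbasis, ?_⟩
  -- the shadow vectors are window-concentrated
  set v : Fin k → Cfg → ℝ := fun i => OpPlat.ins e₀ (g i ∘ powLink L) with hvdef
  have hLnat : 0 < L := hL
  have hR0 : 0 < R := lt_of_lt_of_le one_pos hR1
  have hV : ∀ i : Fin k, IsPhys (v i) ∧
      l2 (v i) (v i) ≤ (1 + Λ ^ 2) * ∑ m ∈ Ico (winLo ((i : ℕ) + 1)) (winHi ((i : ℕ) + 1)), l2 (v i) ((e m : physSubmodule 1) : Cfg → ℝ) ^ 2 ∧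
      0 < ∑ m ∈ Ico (winLo ((i : ℕ) + 1)) (winHi ((i : ℕ) + 1)), l2 (v i) ((e m : physSubmodule 1) : Cfg → ℝ) ^ 2 := fun i =>
    shadowVectors_concentrated hanti e hon heig hdom he₀P he₀n he₀eig horth0 hdom1 hkK hK hF hFpos hΛ hLnat hR0 hRRv hRvΛ Ψ hΨ0 hΨsucc
      hΨphys hΨpos hθ hε hs hκ hgram hgap hsj hκj hsmall hθ0 hCf0 hCf (sq_nonneg Λ) hΛ2 hδ hηsmall i
  -- the dressed clauses
  have hsum' : ∀ (v w : Cfg → ℝ), IsPhys v → IsPhys w → ∀ m n : ℕ, 1 ≤ m + n →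
      HasSum (fun j => levelValue su2Rep 1 B j ^ (m + n) * l2 w ((e j : physSubmodule 1) : Cfg → ℝ) * l2 v ((e j : physSubmodule 1) : Cfg → ℝ))
        (l2 ((transferApply B)^[m] w) ((transferApply B)^[n] v)) := hsum
  have hbes' : ∀ v : Cfg → ℝ, IsPhys v → Summable (fun j => l2 v ((e j : physSubmodule 1) : Cfg → ℝ) ^ 2) ∧
      ∑' j, l2 v ((e j : physSubmodule 1) : Cfg → ℝ) ^ 2 ≤ l2 v v := hbes
  have hD := dressed_clauses_of_concentration' (L := 1) (e := fun m => ((e m : physSubmodule 1) : Cfg → ℝ)) hsum' hbes' hanti hnn hL v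
    (fun i => (hV i).1) (fun i => winLo ((i : ℕ) + 1)) (fun i => winHi ((i : ℕ) + 1)) (fun i => winLo_le _) (fun i => lt_winHi _)
    hσ hlow0 hlow hΓ (sq_nonneg Λ) (fun i => (hV i).2.1) (fun i => (hV i).2.2) hτ0 hτ1 hup hlo' hgapτ
  obtain ⟨hN, hR5, hR6⟩ := hD
  -- dictionary `shadowFamily B L e₀ g i = K^[L] (v i)`
  have hsh : ∀ i, shadowFamily B L e₀ g i = (transferApply B)^[L] (v i) := fun i => rfl
  have hm0 : 0 ≤ lam 0 := hnn 0
  have heC : Real.exp τ ≤ Real.exp (C * Λ ^ 2 / L) := Real.exp_le_exp.2 hτC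
  refine ⟨fun i => by rw [hsh]; exact hN i, fun i => ?_, fun i l hil => ?_⟩
  · rw [hsh]
    obtain ⟨h1, h2⟩ := hR5 i
    have hNi := (hN i).le
    have hli := hnn ((i : ℕ) + 1)
    have hDi : 0 ≤ l2 ((transferApply B)^[L] (v i)) (transferApply B ((transferApply B)^[L] (v i))) := by
      have : 0 ≤ Real.exp τ * l2 ((transferApply B)^[L] (v i)) (transferApply B ((transferApply B)^[L] (v i))) :=
        le_trans (mul_nonneg hli hNi) h2
      exact nonneg_of_mul_nonneg_right (by rwa [mul_comm] at this) (Real.exp_pos τ) |> fun h => by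
        rcases (mul_nonneg_iff_of_pos_left (Real.exp_pos τ)).1 this with h'
        exact h'
    constructor
    · calc l2 ((transferApply B)^[L] (v i)) (transferApply B ((transferApply B)^[L] (v i))) * lam 0
          ≤ Real.exp τ * (lam ((i : ℕ) + 1) * l2 ((transferApply B)^[L] (v i)) ((transferApply B)^[L] (v i))) * lam 0 :=
            mul_le_mul_of_nonneg_right h1 hm0
        _ ≤ Real.exp (C * Λ ^ 2 / L) * (lam ((i : ℕ) + 1) * l2 ((transferApply B)^[L] (v i)) ((transferApply B)^[L] (v i))) * lam 0 :=
            mul_le_mul_of_nonneg_right (mul_le_mul_of_nonneg_right heC (mul_nonneg hli hNi)) hm0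
        _ = Real.exp (C * Λ ^ 2 / L) * (lam ((i : ℕ) + 1) * lam 0) * l2 ((transferApply B)^[L] (v i)) ((transferApply B)^[L] (v i)) := by ring
    · calc lam ((i : ℕ) + 1) * lam 0 * l2 ((transferApply B)^[L] (v i)) ((transferApply B)^[L] (v i))
          = lam ((i : ℕ) + 1) * l2 ((transferApply B)^[L] (v i)) ((transferApply B)^[L] (v i)) * lam 0 := by ring
        _ ≤ Real.exp τ * l2 ((transferApply B)^[L] (v i)) (transferApply B ((transferApply B)^[L] (v i))) * lam 0 :=
            mul_le_mul_of_nonneg_right h2 hm0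
        _ ≤ Real.exp (C * Λ ^ 2 / L) * l2 ((transferApply B)^[L] (v i)) (transferApply B ((transferApply B)^[L] (v i))) * lam 0 :=
            mul_le_mul_of_nonneg_right (mul_le_mul_of_nonneg_right heC hDi) hm0
        _ = Real.exp (C * Λ ^ 2 / L) * (l2 ((transferApply B)^[L] (v i)) (transferApply B ((transferApply B)^[L] (v i))) * lam 0) := by ring
  · rw [hsh, hsh]
    have h := hR6 i l hil
    have hss : 0 ≤ Real.sqrt (l2 ((transferApply B)^[L] (v i)) ((transferApply B)^[L] (v i))) *
        Real.sqrt (l2 ((transferApply B)^[L] (v l)) ((transferApply B)^[L] (v l))) := by positivity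
    exact h.trans (mul_le_mul_of_nonneg_right hΩC hss)

end Summit.QuantumFields.YangMills.Theorems.FemtoTransferGap.PScal

end
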